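/-
Copyright (c) 2026 the pub-hodgecm-mathlib formalisation cell (harness21).  Prover seat hodgecm-mathlib-K2E4-p09 (g2), Track B «K2-LIT» ∕ h413
(`stmt-HodgeConjecture-24833`), line `K2_E3_EllipticInputs`, unit U3b, ROAD J of ‹S_loc›, letter ‹J3› v2 «rank-one mass», road R3, brick F5:
THE EP CONSTANT IN INDEX FORM AT THE WITNESS (unramified non-split places).  2026-09-04.
-/
import Literature.NumberTheory.Rogawski1990.RankOneEulerPoincareNonsplitCentralValueUnramified   -- ★ J2♯ unramified leaf p855639 (K2E4-p08): the explicit triple `K, Ad_d K, K ⊓ Ad_d K`, (W1) `scalar_mem_triple_of_unramified`, `hidx`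
import Summits.HodgeConjecture.HodgeConjecture.Theorems.K2E3EPValueIndexForm                      -- ★ R2 p856144 (K2E4-p03): `mul_toReal_measure_eq_of_epCombination_apply_eq_neg`, `toReal_measure_coe_eq_relIndex_mul`
import HarnessLib

/-!
# K2_E3 road (h413), U3b ROAD J, letter ‹J3› v2, road R3 «rank-one mass» — brick F5: KOTTWITZ'S EP FUNCTION OF `U(Φ₂)_v` KEPT EXPLICIT, ITS CENTRAL VALUE
# `−r` PINNED IN INDEX FORM: `r·ν(I) = 1 − [K:I]⁻¹ − [K′:I]⁻¹`, `r·ν(K) = [K:I]·(1 − [K:I]⁻¹ − [K′:I]⁻¹)` (Kottwitz 1988 §2; Rogawski 1990 §8.1, §12.6)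

Cell `pub/hodgecm-mathlib` (D-0151), Track B, squad K2; dealt BY NAME (dealer K2E4-plan (g2) 01:15:56Z; road owner K2E3-p15 (g2) «=» 01:29:13Z; cut K2E4-p13 (g2)
01:07:45Z «F5 EP CONSTANT IN INDEX FORM AT THE WITNESS»): ★ J2♯'s unramified leaf `exists_isLocSmooth_classOrbitalIntegral_eq_one_zero_and_apply_neg_of_unramified`
delivers Kottwitz's Euler–Poincaré function of the quasi-split rank-one group `U(Φ₂)_v` at an unramified non-split place as `∃ f, … ∃ r > 0, f(a·1) = −r`, with
`r` EXISTENTIAL.  The compatible-measure identity of ‹J3› v2 (`r · aθ · t^ω(Z(ε′)) = 1`) needs THE number `r`.  This file re-runs the leaf with the function KEPT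
EXPLICIT — `f_EP = ν(K)⁻¹𝟙_K + ν(K′)⁻¹𝟙_{K′} − ν(I)⁻¹𝟙_I` on the explicit triple `K = U(Φ₂)(𝒪_v)` (★ `cmLocalIntegralLevel`), `K′ = Ad_d K` (`d = diag(1, ϖ)`,
★ `cmDatumLocalNonsplitCongr`), `I = K ⊓ K′` — so that its central value is the explicit number `ν(K)⁻¹ + ν(K′)⁻¹ − ν(I)⁻¹ = −r`, and ★ R2's index algebra
pins `r` against ANY Haar measure `ν`: `r · ν(I) = 1 − [K:I]⁻¹ − [K′:I]⁻¹` and `r · ν(K) = [K:I] · (1 − [K:I]⁻¹ − [K′:I]⁻¹)`.  GUARD-FREE: only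
`Algebra.IsUnramifiedIn (𝓞 L) v` (no `2 ∉ v`; K2E3-p06 (g3) dyadic census 01:22:27Z), so the inert DYADIC places (d-i) use the same letter.  The two indices
are `q_v + 1` (the star of a hyperspecial vertex of the tree of `U(1,1)`, ★ `natCard_unitaryTwo_star`); that evaluation is a separate brick (F5-idx).

* §1 `epCombination_unramified_spec` — `f_EP` EXPLICIT: locally constant compactly supported, orbital integrals `1 ∕ 0` on the regular elliptic ∕ split classes
  (canonical measures; (E) ★ `epEllipticRelation_of_unramified`, (N) ★ `epNonEllipticRelation`, as glued in ★ `RankOneEulerPoincareGlueCentralValue`), the VALUE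
  `f_EP(a·1) = ν(K)⁻¹ + ν(K′)⁻¹ − ν(I)⁻¹` at every central unit scalar, and the index inequality `ν(K)⁻¹ + ν(K′)⁻¹ < ν(I)⁻¹` (★ (W2)(W3) coset witnesses).
* §2 `neg_epValue_mul_toReal_measure_inf_eq`, `neg_epValue_mul_toReal_measure_level_eq` — the number `r := ν(I)⁻¹ − ν(K)⁻¹ − ν(K′)⁻¹` in index form (★ R2).
* §3 **`exists_epDatum_indexForm_of_unramified`** — THE LETTER in ‹J3› v2's binder order `∃ (f₂) (r : ℝ), IsLocSmooth f₂ ∧ (E) ∧ (N) ∧ (f₂(b·1) = −r) ∧ …`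
  WITH `0 < r` and the two index identities appended: the `r` of ‹J3› is THIS `r`.

THEOREMS ONLY; lane `--supports stmt-HodgeConjecture-24833 --as helper`.  HONEST LABEL: HC_CM is proved only modulo the 7 printed citations (2 remaining named inputs:
hLiu418 = stmt-HodgeConjecture-24832, h413 = stmt-HodgeConjecture-24833) until rung 0 closes; count-neutral helper (R3 «the two numbers» is the open core of ‹J3›).

## References
* [Kottwitz1988] R. E. Kottwitz, *Tamagawa numbers*, Ann. of Math. 127 (1988) 629–646: §2 Theorem 2 (the Euler–Poincaré function and its orbital integrals).
* [Rogawski1990] J. D. Rogawski, *Automorphic Representations of Unitary Groups in Three Variables*, Ann. of Math. Stud. 123 (1990), §8.1 p. 117; §12.6 p. 174.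
* [Serre1980Trees] J.-P. Serre, *Trees* (1980), Ch. II §1.1 (the tree of `SL₂` over a local field; stars of vertices).
* [DeitmarEchterhoff2014] A. Deitmar, S. Echterhoff, *Principles of Harmonic Analysis*, 2nd ed. (2014), Thm. 1.5.3 (index = ratio of Haar measures).
-/

set_option autoImplicit false
-- the mandated namespace repeats the single-problem summit's segment (`HodgeConjecture.HodgeConjecture`), as in every `Theorems/*.lean` of this sub-problem
set_option linter.dupNamespace false

noncomputable section

open scoped ValuativeRel Matrix MatrixGroups ENNReal NNReal
open Matrix NumberField IsDedekindDomain MulAction MeasureTheory Measure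

namespace Summit.HodgeConjecture.HodgeConjecture.Cruxes.H413.K2E3EPConstantIndexFormUnramified

open Literature.NumberTheory.Rogawski1990
open Literature.NumberTheory.Automorphic Literature.NumberTheory.Automorphic.UnitaryGroup Literature.NumberTheory.GaloisRepresentations
open Literature.MeasureTheory.Group
open Summit.HodgeConjecture.HodgeConjecture.Cruxes.H413.K2E3EPValueIndexForm

variable (L : Type) [Field L] [NumberField L] [IsCMField L] {v : HeightOneSpectrum (𝓞 ↥(maximalRealSubfield L))}
  (w : PlacesOver L v) (hw : IsCMField.complexConj L • w.1 = w.1)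
  (ϖ : (w.1.adicCompletion L)ˣ) (hϖ : Valued.v (ϖ : w.1.adicCompletion L) = WithZero.exp (-1 : ℤ))
  (hσϖ : galAdicCompletionMap (L := L) (IsCMField.complexConj L) hw (ϖ : w.1.adicCompletion L) = ϖ)
  [MeasurableSpace ((cmDatum L 2 (Matrix.of fun i j : Fin 2 => if i.val + j.val + 1 = 2 then (1 : L) else 0)).Local v)]
  [BorelSpace ((cmDatum L 2 (Matrix.of fun i j : Fin 2 => if i.val + j.val + 1 = 2 then (1 : L) else 0)).Local v)]
  [∀ γ : (cmDatum L 2 (Matrix.of fun i j : Fin 2 => if i.val + j.val + 1 = 2 then (1 : L) else 0)).Local v,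
    MeasurableSpace (((cmDatum L 2 (Matrix.of fun i j : Fin 2 => if i.val + j.val + 1 = 2 then (1 : L) else 0)).Local v) ⧸
      Subgroup.centralizer ({γ} : Set ((cmDatum L 2 (Matrix.of fun i j : Fin 2 => if i.val + j.val + 1 = 2 then (1 : L) else 0)).Local v)))]
  [∀ γ : (cmDatum L 2 (Matrix.of fun i j : Fin 2 => if i.val + j.val + 1 = 2 then (1 : L) else 0)).Local v,
    BorelSpace (((cmDatum L 2 (Matrix.of fun i j : Fin 2 => if i.val + j.val + 1 = 2 then (1 : L) else 0)).Local v) ⧸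
      Subgroup.centralizer ({γ} : Set ((cmDatum L 2 (Matrix.of fun i j : Fin 2 => if i.val + j.val + 1 = 2 then (1 : L) else 0)).Local v)))]
  (ν : Measure ((cmDatum L 2 (Matrix.of fun i j : Fin 2 => if i.val + j.val + 1 = 2 then (1 : L) else 0)).Local v))
  [IsHaarMeasure ν] [ν.IsMulRightInvariant]

/-! ## §1 Kottwitz's EP function on the explicit triple, kept explicit, with its central VALUE -/

include hw hϖ hσϖ in
/-- **KOTTWITZ'S EP FUNCTION OF `U(Φ₂)_v` AT AN UNRAMIFIED NON-SPLIT PLACE, EXPLICIT.**  For `v` unramified in `L` (inert: `w ∣ v`, `w̄ = w`), any two-sided Haar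
measure `ν` and canonical orbital measures `m` on `U(Φ₂)_v`, the EXPLICIT function `f_EP = ν(K)⁻¹𝟙_K + ν(K′)⁻¹𝟙_{K′} − ν(I)⁻¹𝟙_I` on the triple `K = U(Φ₂)(𝒪_v)`,
`K′ = Ad_d K` (`d = diag(1, ϖ)`), `I = K ⊓ K′` is locally constant and compactly supported, has orbital integral `1` on every regular elliptic class and `0` on every
regular split class, takes the VALUE `ν(K)⁻¹ + ν(K′)⁻¹ − ν(I)⁻¹` at every central unit scalar `z = a·1`, and `ν(K)⁻¹ + ν(K′)⁻¹ < ν(I)⁻¹` (so that value is negative).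
★ J2♯'s leaf, re-run with the witness in the open. [cite: Kottwitz1988, §2 Theorem 2] [cite: Rogawski1990, §12.6 p. 174; §8.1 p. 117] [cite: Serre1980Trees, Ch. II §1.1] -/
theorem epCombination_unramified_spec (hunr : Algebra.IsUnramifiedIn (𝓞 L) v.asIdeal)
    {m : OrbitalMeasureFamily ((cmDatum L 2 (Matrix.of fun i j : Fin 2 => if i.val + j.val + 1 = 2 then (1 : L) else 0)).Local v)}
    (hm : m.IsCanonical (fun γ => IsRegularElt (γ.val : GL (Fin 2) (UnitaryGroup.LocalRing L v))) ν) :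
    IsLocSmooth (fun g : (cmDatum L 2 (Matrix.of fun i j : Fin 2 => if i.val + j.val + 1 = 2 then (1 : L) else 0)).Local v =>
      (((ν (cmLocalIntegralLevel L 2 (Matrix.of fun i j : Fin 2 => if i.val + j.val + 1 = 2 then (1 : L) else 0) v)).toReal : ℂ))⁻¹ *
          (cmLocalIntegralLevel L 2 (Matrix.of fun i j : Fin 2 => if i.val + j.val + 1 = 2 then (1 : L) else 0) v :
            Set ((cmDatum L 2 (Matrix.of fun i j : Fin 2 => if i.val + j.val + 1 = 2 then (1 : L) else 0)).Local v)).indicator (fun _ => (1 : ℂ)) g +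
        (((ν ((cmLocalIntegralLevel L 2 (Matrix.of fun i j : Fin 2 => if i.val + j.val + 1 = 2 then (1 : L) else 0) v).map
            (cmDatumLocalNonsplitCongr L w hw (glDiagonal 2 (w.1.adicCompletion L) ![1, ϖ]) ϖ.isUnit
              (formCongr_glDiagonal_eq_smul_two L w hw ϖ hσϖ)).toMulEquiv.toMonoidHom)).toReal : ℂ))⁻¹ *
          ((cmLocalIntegralLevel L 2 (Matrix.of fun i j : Fin 2 => if i.val + j.val + 1 = 2 then (1 : L) else 0) v).map
            (cmDatumLocalNonsplitCongr L w hw (glDiagonal 2 (w.1.adicCompletion L) ![1, ϖ]) ϖ.isUnit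
              (formCongr_glDiagonal_eq_smul_two L w hw ϖ hσϖ)).toMulEquiv.toMonoidHom :
            Set ((cmDatum L 2 (Matrix.of fun i j : Fin 2 => if i.val + j.val + 1 = 2 then (1 : L) else 0)).Local v)).indicator (fun _ => (1 : ℂ)) g -
        (((ν (↑(cmLocalIntegralLevel L 2 (Matrix.of fun i j : Fin 2 => if i.val + j.val + 1 = 2 then (1 : L) else 0) v ⊓
            (cmLocalIntegralLevel L 2 (Matrix.of fun i j : Fin 2 => if i.val + j.val + 1 = 2 then (1 : L) else 0) v).map
              (cmDatumLocalNonsplitCongr L w hw (glDiagonal 2 (w.1.adicCompletion L) ![1, ϖ]) ϖ.isUnit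
                (formCongr_glDiagonal_eq_smul_two L w hw ϖ hσϖ)).toMulEquiv.toMonoidHom))).toReal : ℂ))⁻¹ *
          (↑(cmLocalIntegralLevel L 2 (Matrix.of fun i j : Fin 2 => if i.val + j.val + 1 = 2 then (1 : L) else 0) v ⊓
              (cmLocalIntegralLevel L 2 (Matrix.of fun i j : Fin 2 => if i.val + j.val + 1 = 2 then (1 : L) else 0) v).map
                (cmDatumLocalNonsplitCongr L w hw (glDiagonal 2 (w.1.adicCompletion L) ![1, ϖ]) ϖ.isUnit
                  (formCongr_glDiagonal_eq_smul_two L w hw ϖ hσϖ)).toMulEquiv.toMonoidHom) :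
            Set ((cmDatum L 2 (Matrix.of fun i j : Fin 2 => if i.val + j.val + 1 = 2 then (1 : L) else 0)).Local v)).indicator (fun _ => (1 : ℂ)) g) ∧
    (∀ γ : (cmDatum L 2 (Matrix.of fun i j : Fin 2 => if i.val + j.val + 1 = 2 then (1 : L) else 0)).Local v,
        IsRegularElt (γ.val : GL (Fin 2) (UnitaryGroup.LocalRing L v)) →
        CompactSpace (Subgroup.centralizer ({γ} : Set ((cmDatum L 2 (Matrix.of fun i j : Fin 2 => if i.val + j.val + 1 = 2 then (1 : L) else 0)).Local v))) →
        classOrbitalIntegral m (fun g : (cmDatum L 2 (Matrix.of fun i j : Fin 2 => if i.val + j.val + 1 = 2 then (1 : L) else 0)).Local v =>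
          (((ν (cmLocalIntegralLevel L 2 (Matrix.of fun i j : Fin 2 => if i.val + j.val + 1 = 2 then (1 : L) else 0) v)).toReal : ℂ))⁻¹ *
              (cmLocalIntegralLevel L 2 (Matrix.of fun i j : Fin 2 => if i.val + j.val + 1 = 2 then (1 : L) else 0) v :
                Set ((cmDatum L 2 (Matrix.of fun i j : Fin 2 => if i.val + j.val + 1 = 2 then (1 : L) else 0)).Local v)).indicator (fun _ => (1 : ℂ)) g +
            (((ν ((cmLocalIntegralLevel L 2 (Matrix.of fun i j : Fin 2 => if i.val + j.val + 1 = 2 then (1 : L) else 0) v).map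
                (cmDatumLocalNonsplitCongr L w hw (glDiagonal 2 (w.1.adicCompletion L) ![1, ϖ]) ϖ.isUnit
                  (formCongr_glDiagonal_eq_smul_two L w hw ϖ hσϖ)).toMulEquiv.toMonoidHom)).toReal : ℂ))⁻¹ *
              ((cmLocalIntegralLevel L 2 (Matrix.of fun i j : Fin 2 => if i.val + j.val + 1 = 2 then (1 : L) else 0) v).map
                (cmDatumLocalNonsplitCongr L w hw (glDiagonal 2 (w.1.adicCompletion L) ![1, ϖ]) ϖ.isUnit
                  (formCongr_glDiagonal_eq_smul_two L w hw ϖ hσϖ)).toMulEquiv.toMonoidHom :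
                Set ((cmDatum L 2 (Matrix.of fun i j : Fin 2 => if i.val + j.val + 1 = 2 then (1 : L) else 0)).Local v)).indicator (fun _ => (1 : ℂ)) g -
            (((ν (↑(cmLocalIntegralLevel L 2 (Matrix.of fun i j : Fin 2 => if i.val + j.val + 1 = 2 then (1 : L) else 0) v ⊓
                (cmLocalIntegralLevel L 2 (Matrix.of fun i j : Fin 2 => if i.val + j.val + 1 = 2 then (1 : L) else 0) v).map
                  (cmDatumLocalNonsplitCongr L w hw (glDiagonal 2 (w.1.adicCompletion L) ![1, ϖ]) ϖ.isUnit
                    (formCongr_glDiagonal_eq_smul_two L w hw ϖ hσϖ)).toMulEquiv.toMonoidHom))).toReal : ℂ))⁻¹ *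
              (↑(cmLocalIntegralLevel L 2 (Matrix.of fun i j : Fin 2 => if i.val + j.val + 1 = 2 then (1 : L) else 0) v ⊓
                  (cmLocalIntegralLevel L 2 (Matrix.of fun i j : Fin 2 => if i.val + j.val + 1 = 2 then (1 : L) else 0) v).map
                    (cmDatumLocalNonsplitCongr L w hw (glDiagonal 2 (w.1.adicCompletion L) ![1, ϖ]) ϖ.isUnit
                      (formCongr_glDiagonal_eq_smul_two L w hw ϖ hσϖ)).toMulEquiv.toMonoidHom) :
                Set ((cmDatum L 2 (Matrix.of fun i j : Fin 2 => if i.val + j.val + 1 = 2 then (1 : L) else 0)).Local v)).indicator (fun _ => (1 : ℂ)) g)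
          (ConjClasses.mk γ) = 1) ∧
    (∀ γ : (cmDatum L 2 (Matrix.of fun i j : Fin 2 => if i.val + j.val + 1 = 2 then (1 : L) else 0)).Local v,
        IsRegularElt (γ.val : GL (Fin 2) (UnitaryGroup.LocalRing L v)) →
        ¬ CompactSpace (Subgroup.centralizer ({γ} : Set ((cmDatum L 2 (Matrix.of fun i j : Fin 2 => if i.val + j.val + 1 = 2 then (1 : L) else 0)).Local v))) →
        classOrbitalIntegral m (fun g : (cmDatum L 2 (Matrix.of fun i j : Fin 2 => if i.val + j.val + 1 = 2 then (1 : L) else 0)).Local v =>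
          (((ν (cmLocalIntegralLevel L 2 (Matrix.of fun i j : Fin 2 => if i.val + j.val + 1 = 2 then (1 : L) else 0) v)).toReal : ℂ))⁻¹ *
              (cmLocalIntegralLevel L 2 (Matrix.of fun i j : Fin 2 => if i.val + j.val + 1 = 2 then (1 : L) else 0) v :
                Set ((cmDatum L 2 (Matrix.of fun i j : Fin 2 => if i.val + j.val + 1 = 2 then (1 : L) else 0)).Local v)).indicator (fun _ => (1 : ℂ)) g +
            (((ν ((cmLocalIntegralLevel L 2 (Matrix.of fun i j : Fin 2 => if i.val + j.val + 1 = 2 then (1 : L) else 0) v).map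
                (cmDatumLocalNonsplitCongr L w hw (glDiagonal 2 (w.1.adicCompletion L) ![1, ϖ]) ϖ.isUnit
                  (formCongr_glDiagonal_eq_smul_two L w hw ϖ hσϖ)).toMulEquiv.toMonoidHom)).toReal : ℂ))⁻¹ *
              ((cmLocalIntegralLevel L 2 (Matrix.of fun i j : Fin 2 => if i.val + j.val + 1 = 2 then (1 : L) else 0) v).map
                (cmDatumLocalNonsplitCongr L w hw (glDiagonal 2 (w.1.adicCompletion L) ![1, ϖ]) ϖ.isUnit
                  (formCongr_glDiagonal_eq_smul_two L w hw ϖ hσϖ)).toMulEquiv.toMonoidHom :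
                Set ((cmDatum L 2 (Matrix.of fun i j : Fin 2 => if i.val + j.val + 1 = 2 then (1 : L) else 0)).Local v)).indicator (fun _ => (1 : ℂ)) g -
            (((ν (↑(cmLocalIntegralLevel L 2 (Matrix.of fun i j : Fin 2 => if i.val + j.val + 1 = 2 then (1 : L) else 0) v ⊓
                (cmLocalIntegralLevel L 2 (Matrix.of fun i j : Fin 2 => if i.val + j.val + 1 = 2 then (1 : L) else 0) v).map
                  (cmDatumLocalNonsplitCongr L w hw (glDiagonal 2 (w.1.adicCompletion L) ![1, ϖ]) ϖ.isUnit
                    (formCongr_glDiagonal_eq_smul_two L w hw ϖ hσϖ)).toMulEquiv.toMonoidHom))).toReal : ℂ))⁻¹ *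
              (↑(cmLocalIntegralLevel L 2 (Matrix.of fun i j : Fin 2 => if i.val + j.val + 1 = 2 then (1 : L) else 0) v ⊓
                  (cmLocalIntegralLevel L 2 (Matrix.of fun i j : Fin 2 => if i.val + j.val + 1 = 2 then (1 : L) else 0) v).map
                    (cmDatumLocalNonsplitCongr L w hw (glDiagonal 2 (w.1.adicCompletion L) ![1, ϖ]) ϖ.isUnit
                      (formCongr_glDiagonal_eq_smul_two L w hw ϖ hσϖ)).toMulEquiv.toMonoidHom) :
                Set ((cmDatum L 2 (Matrix.of fun i j : Fin 2 => if i.val + j.val + 1 = 2 then (1 : L) else 0)).Local v)).indicator (fun _ => (1 : ℂ)) g)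
          (ConjClasses.mk γ) = 0) ∧
    (∀ (z : (cmDatum L 2 (Matrix.of fun i j : Fin 2 => if i.val + j.val + 1 = 2 then (1 : L) else 0)).Local v) (a : LocalRing L v),
        ((z.val : GL (Fin 2) (LocalRing L v)).val : Matrix (Fin 2) (Fin 2) (LocalRing L v)) = a • (1 : Matrix (Fin 2) (Fin 2) (LocalRing L v)) →
        (((ν (cmLocalIntegralLevel L 2 (Matrix.of fun i j : Fin 2 => if i.val + j.val + 1 = 2 then (1 : L) else 0) v)).toReal : ℂ))⁻¹ *
              (cmLocalIntegralLevel L 2 (Matrix.of fun i j : Fin 2 => if i.val + j.val + 1 = 2 then (1 : L) else 0) v :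
                Set ((cmDatum L 2 (Matrix.of fun i j : Fin 2 => if i.val + j.val + 1 = 2 then (1 : L) else 0)).Local v)).indicator (fun _ => (1 : ℂ)) z +
            (((ν ((cmLocalIntegralLevel L 2 (Matrix.of fun i j : Fin 2 => if i.val + j.val + 1 = 2 then (1 : L) else 0) v).map
                (cmDatumLocalNonsplitCongr L w hw (glDiagonal 2 (w.1.adicCompletion L) ![1, ϖ]) ϖ.isUnit
                  (formCongr_glDiagonal_eq_smul_two L w hw ϖ hσϖ)).toMulEquiv.toMonoidHom)).toReal : ℂ))⁻¹ *
              ((cmLocalIntegralLevel L 2 (Matrix.of fun i j : Fin 2 => if i.val + j.val + 1 = 2 then (1 : L) else 0) v).map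
                (cmDatumLocalNonsplitCongr L w hw (glDiagonal 2 (w.1.adicCompletion L) ![1, ϖ]) ϖ.isUnit
                  (formCongr_glDiagonal_eq_smul_two L w hw ϖ hσϖ)).toMulEquiv.toMonoidHom :
                Set ((cmDatum L 2 (Matrix.of fun i j : Fin 2 => if i.val + j.val + 1 = 2 then (1 : L) else 0)).Local v)).indicator (fun _ => (1 : ℂ)) z -
            (((ν (↑(cmLocalIntegralLevel L 2 (Matrix.of fun i j : Fin 2 => if i.val + j.val + 1 = 2 then (1 : L) else 0) v ⊓
                (cmLocalIntegralLevel L 2 (Matrix.of fun i j : Fin 2 => if i.val + j.val + 1 = 2 then (1 : L) else 0) v).map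
                  (cmDatumLocalNonsplitCongr L w hw (glDiagonal 2 (w.1.adicCompletion L) ![1, ϖ]) ϖ.isUnit
                    (formCongr_glDiagonal_eq_smul_two L w hw ϖ hσϖ)).toMulEquiv.toMonoidHom))).toReal : ℂ))⁻¹ *
              (↑(cmLocalIntegralLevel L 2 (Matrix.of fun i j : Fin 2 => if i.val + j.val + 1 = 2 then (1 : L) else 0) v ⊓
                  (cmLocalIntegralLevel L 2 (Matrix.of fun i j : Fin 2 => if i.val + j.val + 1 = 2 then (1 : L) else 0) v).map
                    (cmDatumLocalNonsplitCongr L w hw (glDiagonal 2 (w.1.adicCompletion L) ![1, ϖ]) ϖ.isUnit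
                      (formCongr_glDiagonal_eq_smul_two L w hw ϖ hσϖ)).toMulEquiv.toMonoidHom) :
                Set ((cmDatum L 2 (Matrix.of fun i j : Fin 2 => if i.val + j.val + 1 = 2 then (1 : L) else 0)).Local v)).indicator (fun _ => (1 : ℂ)) z =
          (((ν (cmLocalIntegralLevel L 2 (Matrix.of fun i j : Fin 2 => if i.val + j.val + 1 = 2 then (1 : L) else 0) v)).toReal : ℂ))⁻¹ +
            (((ν ((cmLocalIntegralLevel L 2 (Matrix.of fun i j : Fin 2 => if i.val + j.val + 1 = 2 then (1 : L) else 0) v).map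
                (cmDatumLocalNonsplitCongr L w hw (glDiagonal 2 (w.1.adicCompletion L) ![1, ϖ]) ϖ.isUnit
                  (formCongr_glDiagonal_eq_smul_two L w hw ϖ hσϖ)).toMulEquiv.toMonoidHom)).toReal : ℂ))⁻¹ -
            (((ν (↑(cmLocalIntegralLevel L 2 (Matrix.of fun i j : Fin 2 => if i.val + j.val + 1 = 2 then (1 : L) else 0) v ⊓
                (cmLocalIntegralLevel L 2 (Matrix.of fun i j : Fin 2 => if i.val + j.val + 1 = 2 then (1 : L) else 0) v).map
                  (cmDatumLocalNonsplitCongr L w hw (glDiagonal 2 (w.1.adicCompletion L) ![1, ϖ]) ϖ.isUnit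
                    (formCongr_glDiagonal_eq_smul_two L w hw ϖ hσϖ)).toMulEquiv.toMonoidHom))).toReal : ℂ))⁻¹) ∧
    (ν (cmLocalIntegralLevel L 2 (Matrix.of fun i j : Fin 2 => if i.val + j.val + 1 = 2 then (1 : L) else 0) v :
          Set ((cmDatum L 2 (Matrix.of fun i j : Fin 2 => if i.val + j.val + 1 = 2 then (1 : L) else 0)).Local v))).toReal⁻¹ +
        (ν ((cmLocalIntegralLevel L 2 (Matrix.of fun i j : Fin 2 => if i.val + j.val + 1 = 2 then (1 : L) else 0) v).map
            (cmDatumLocalNonsplitCongr L w hw (glDiagonal 2 (w.1.adicCompletion L) ![1, ϖ]) ϖ.isUnit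
              (formCongr_glDiagonal_eq_smul_two L w hw ϖ hσϖ)).toMulEquiv.toMonoidHom :
          Set ((cmDatum L 2 (Matrix.of fun i j : Fin 2 => if i.val + j.val + 1 = 2 then (1 : L) else 0)).Local v))).toReal⁻¹ <
      (ν (↑(cmLocalIntegralLevel L 2 (Matrix.of fun i j : Fin 2 => if i.val + j.val + 1 = 2 then (1 : L) else 0) v ⊓
            (cmLocalIntegralLevel L 2 (Matrix.of fun i j : Fin 2 => if i.val + j.val + 1 = 2 then (1 : L) else 0) v).map
              (cmDatumLocalNonsplitCongr L w hw (glDiagonal 2 (w.1.adicCompletion L) ![1, ϖ]) ϖ.isUnit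
                (formCongr_glDiagonal_eq_smul_two L w hw ϖ hσϖ)).toMulEquiv.toMonoidHom) :
          Set ((cmDatum L 2 (Matrix.of fun i j : Fin 2 => if i.val + j.val + 1 = 2 then (1 : L) else 0)).Local v))).toReal⁻¹ := by
  obtain ⟨hKc, hKo⟩ := isCompact_isOpen_cmLocalIntegralLevel L 2 (Matrix.of fun i j : Fin 2 => if i.val + j.val + 1 = 2 then (1 : L) else 0) v
  obtain ⟨hK'c, hK'o⟩ := isCompact_isOpen_map_cmDatumLocalNonsplitCongr_cmLocalIntegralLevel L w hw ϖ hσϖ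
  obtain ⟨hIc, hIo⟩ := isCompact_isOpen_cmLocalIntegralLevel_inf_map L w hw ϖ hσϖ
  have hE := epEllipticRelation_of_unramified L w hw ϖ hϖ hσϖ hunr
  have hN := epNonEllipticRelation L w hw ϖ hϖ hσϖ ν hm
  refine ⟨isLocSmooth_epCombination _ _ _ hKo hKc hK'o hK'c hIo hIc _ _ _, fun γ hreg hc => ?_, fun γ hreg hnc => ?_, fun z a hz => ?_,
    toReal_inv_add_toReal_inv_lt_of_unramified L w hw ϖ hϖ hσϖ ν hunr⟩
  · rw [classOrbitalIntegral_epCombination_eq_of_compactSpace L 2 _ v ν (UnitaryGroup.antidiagOne_isHermitian L 2) (UnitaryGroup.isUnit_antidiagOne_det L 2).ne_zero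
      hm _ _ _ hKo hKc hK'o hK'c hIo hIc γ hreg]
    have h := hE γ hreg hc
    have h' : (Nat.card (MulAction.fixedBy ((cmDatum L 2 (Matrix.of fun i j : Fin 2 => if i.val + j.val + 1 = 2 then (1 : L) else 0)).Local v ⧸
          cmLocalIntegralLevel L 2 (Matrix.of fun i j : Fin 2 => if i.val + j.val + 1 = 2 then (1 : L) else 0) v) γ) : ℂ) +
        (Nat.card (MulAction.fixedBy ((cmDatum L 2 (Matrix.of fun i j : Fin 2 => if i.val + j.val + 1 = 2 then (1 : L) else 0)).Local v ⧸
          (cmLocalIntegralLevel L 2 (Matrix.of fun i j : Fin 2 => if i.val + j.val + 1 = 2 then (1 : L) else 0) v).map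
            (cmDatumLocalNonsplitCongr L w hw (glDiagonal 2 (w.1.adicCompletion L) ![1, ϖ]) ϖ.isUnit
              (formCongr_glDiagonal_eq_smul_two L w hw ϖ hσϖ)).toMulEquiv.toMonoidHom) γ) : ℂ) =
        (Nat.card (MulAction.fixedBy ((cmDatum L 2 (Matrix.of fun i j : Fin 2 => if i.val + j.val + 1 = 2 then (1 : L) else 0)).Local v ⧸
          (cmLocalIntegralLevel L 2 (Matrix.of fun i j : Fin 2 => if i.val + j.val + 1 = 2 then (1 : L) else 0) v ⊓
            (cmLocalIntegralLevel L 2 (Matrix.of fun i j : Fin 2 => if i.val + j.val + 1 = 2 then (1 : L) else 0) v).map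
              (cmDatumLocalNonsplitCongr L w hw (glDiagonal 2 (w.1.adicCompletion L) ![1, ϖ]) ϖ.isUnit
                (formCongr_glDiagonal_eq_smul_two L w hw ϖ hσϖ)).toMulEquiv.toMonoidHom)) γ) : ℂ) + 1 := by
      exact_mod_cast h
    rw [h', add_sub_cancel_left]
  · rw [classOrbitalIntegral_epCombination_eq L 2 _ v (UnitaryGroup.antidiagOne_isHermitian L 2) (UnitaryGroup.isUnit_antidiagOne_det L 2).ne_zero
      hm.isAdmissibleOn _ _ _ hKo hKc hK'o hK'c hIo hIc _ _ _ γ hreg]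
    exact hN γ hreg hnc
  · obtain ⟨hzK, hzK', hzI⟩ := scalar_mem_triple_of_unramified L w hw ϖ hσϖ z a hz
    exact epCombination_apply_of_mem _ _ _ _ _ _ hzK hzK' hzI

/-! ## §2 The number `r = ν(I)⁻¹ − ν(K)⁻¹ − ν(K′)⁻¹` in index form (★ R2) -/

omit [IsCMField L] in
/-- Arithmetic: `x⁻¹ + y⁻¹ − u⁻¹ = −(u⁻¹ − x⁻¹ − y⁻¹)` in `ℂ` through the real casts (`Complex.ofReal_inv`). [cite: Rogawski1990, §8.1 p. 117] -/
theorem inv_add_inv_sub_inv_eq_neg (x y u : ℝ) : ((x : ℂ)⁻¹ + (y : ℂ)⁻¹ - (u : ℂ)⁻¹) = -((u⁻¹ - x⁻¹ - y⁻¹ : ℝ) : ℂ) := by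
  push_cast; ring

omit
  [∀ γ : (cmDatum L 2 (Matrix.of fun i j : Fin 2 => if i.val + j.val + 1 = 2 then (1 : L) else 0)).Local v,
    MeasurableSpace (((cmDatum L 2 (Matrix.of fun i j : Fin 2 => if i.val + j.val + 1 = 2 then (1 : L) else 0)).Local v) ⧸
      Subgroup.centralizer ({γ} : Set ((cmDatum L 2 (Matrix.of fun i j : Fin 2 => if i.val + j.val + 1 = 2 then (1 : L) else 0)).Local v)))]
  [∀ γ : (cmDatum L 2 (Matrix.of fun i j : Fin 2 => if i.val + j.val + 1 = 2 then (1 : L) else 0)).Local v,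
    BorelSpace (((cmDatum L 2 (Matrix.of fun i j : Fin 2 => if i.val + j.val + 1 = 2 then (1 : L) else 0)).Local v) ⧸
      Subgroup.centralizer ({γ} : Set ((cmDatum L 2 (Matrix.of fun i j : Fin 2 => if i.val + j.val + 1 = 2 then (1 : L) else 0)).Local v)))]
  [ν.IsMulRightInvariant] in
/-- **`r · ν(I) = 1 − [K:I]⁻¹ − [K′:I]⁻¹`** for `r := ν(I)⁻¹ − ν(K)⁻¹ − ν(K′)⁻¹` on the explicit triple of `U(Φ₂)_v` (any Haar `ν`): ★ R2
`mul_toReal_measure_eq_of_epCombination_apply_eq_neg` at `K₀ = I`, `z = 1` (`[I:I] = 1`). [cite: Kottwitz1988, §2 Theorem 2] [cite: Rogawski1990, §12.6 p. 174] -/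
theorem neg_epValue_mul_toReal_measure_inf_eq :
    (((ν (↑(cmLocalIntegralLevel L 2 (Matrix.of fun i j : Fin 2 => if i.val + j.val + 1 = 2 then (1 : L) else 0) v ⊓
            (cmLocalIntegralLevel L 2 (Matrix.of fun i j : Fin 2 => if i.val + j.val + 1 = 2 then (1 : L) else 0) v).map
              (cmDatumLocalNonsplitCongr L w hw (glDiagonal 2 (w.1.adicCompletion L) ![1, ϖ]) ϖ.isUnit
                (formCongr_glDiagonal_eq_smul_two L w hw ϖ hσϖ)).toMulEquiv.toMonoidHom) :
          Set ((cmDatum L 2 (Matrix.of fun i j : Fin 2 => if i.val + j.val + 1 = 2 then (1 : L) else 0)).Local v))).toReal⁻¹ -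
        (ν (cmLocalIntegralLevel L 2 (Matrix.of fun i j : Fin 2 => if i.val + j.val + 1 = 2 then (1 : L) else 0) v :
          Set ((cmDatum L 2 (Matrix.of fun i j : Fin 2 => if i.val + j.val + 1 = 2 then (1 : L) else 0)).Local v))).toReal⁻¹ -
        (ν ((cmLocalIntegralLevel L 2 (Matrix.of fun i j : Fin 2 => if i.val + j.val + 1 = 2 then (1 : L) else 0) v).map
            (cmDatumLocalNonsplitCongr L w hw (glDiagonal 2 (w.1.adicCompletion L) ![1, ϖ]) ϖ.isUnit
              (formCongr_glDiagonal_eq_smul_two L w hw ϖ hσϖ)).toMulEquiv.toMonoidHom :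
          Set ((cmDatum L 2 (Matrix.of fun i j : Fin 2 => if i.val + j.val + 1 = 2 then (1 : L) else 0)).Local v))).toReal⁻¹ : ℝ) : ℂ) *
      ((ν (↑(cmLocalIntegralLevel L 2 (Matrix.of fun i j : Fin 2 => if i.val + j.val + 1 = 2 then (1 : L) else 0) v ⊓
            (cmLocalIntegralLevel L 2 (Matrix.of fun i j : Fin 2 => if i.val + j.val + 1 = 2 then (1 : L) else 0) v).map
              (cmDatumLocalNonsplitCongr L w hw (glDiagonal 2 (w.1.adicCompletion L) ![1, ϖ]) ϖ.isUnit
                (formCongr_glDiagonal_eq_smul_two L w hw ϖ hσϖ)).toMulEquiv.toMonoidHom) :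
          Set ((cmDatum L 2 (Matrix.of fun i j : Fin 2 => if i.val + j.val + 1 = 2 then (1 : L) else 0)).Local v))).toReal : ℂ) =
      1 - (((cmLocalIntegralLevel L 2 (Matrix.of fun i j : Fin 2 => if i.val + j.val + 1 = 2 then (1 : L) else 0) v ⊓
            (cmLocalIntegralLevel L 2 (Matrix.of fun i j : Fin 2 => if i.val + j.val + 1 = 2 then (1 : L) else 0) v).map
              (cmDatumLocalNonsplitCongr L w hw (glDiagonal 2 (w.1.adicCompletion L) ![1, ϖ]) ϖ.isUnit
                (formCongr_glDiagonal_eq_smul_two L w hw ϖ hσϖ)).toMulEquiv.toMonoidHom).relIndex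
            (cmLocalIntegralLevel L 2 (Matrix.of fun i j : Fin 2 => if i.val + j.val + 1 = 2 then (1 : L) else 0) v) : ℕ) : ℂ)⁻¹ -
        (((cmLocalIntegralLevel L 2 (Matrix.of fun i j : Fin 2 => if i.val + j.val + 1 = 2 then (1 : L) else 0) v ⊓
            (cmLocalIntegralLevel L 2 (Matrix.of fun i j : Fin 2 => if i.val + j.val + 1 = 2 then (1 : L) else 0) v).map
              (cmDatumLocalNonsplitCongr L w hw (glDiagonal 2 (w.1.adicCompletion L) ![1, ϖ]) ϖ.isUnit
                (formCongr_glDiagonal_eq_smul_two L w hw ϖ hσϖ)).toMulEquiv.toMonoidHom).relIndex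
            ((cmLocalIntegralLevel L 2 (Matrix.of fun i j : Fin 2 => if i.val + j.val + 1 = 2 then (1 : L) else 0) v).map
              (cmDatumLocalNonsplitCongr L w hw (glDiagonal 2 (w.1.adicCompletion L) ![1, ϖ]) ϖ.isUnit
                (formCongr_glDiagonal_eq_smul_two L w hw ϖ hσϖ)).toMulEquiv.toMonoidHom) : ℕ) : ℂ)⁻¹ := by
  obtain ⟨hKc, hKo⟩ := isCompact_isOpen_cmLocalIntegralLevel L 2 (Matrix.of fun i j : Fin 2 => if i.val + j.val + 1 = 2 then (1 : L) else 0) v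
  obtain ⟨hK'c, hK'o⟩ := isCompact_isOpen_map_cmDatumLocalNonsplitCongr_cmLocalIntegralLevel L w hw ϖ hσϖ
  obtain ⟨hIc, hIo⟩ := isCompact_isOpen_cmLocalIntegralLevel_inf_map L w hw ϖ hσϖ
  have h := mul_toReal_measure_eq_of_epCombination_apply_eq_neg ν _ _ _ _ hKo hKc hK'o hK'c hIo hIc hIo hIc inf_le_left inf_le_right le_rfl
    (Subgroup.one_mem _) (Subgroup.one_mem _) (Subgroup.one_mem _)
    ((epCombination_apply_of_mem _ _ _ _ _ _ (Subgroup.one_mem _) (Subgroup.one_mem _) (Subgroup.one_mem _)).trans (inv_add_inv_sub_inv_eq_neg _ _ _))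
  rw [Subgroup.relIndex_self, Nat.cast_one, inv_one] at h
  exact h

omit
  [∀ γ : (cmDatum L 2 (Matrix.of fun i j : Fin 2 => if i.val + j.val + 1 = 2 then (1 : L) else 0)).Local v,
    MeasurableSpace (((cmDatum L 2 (Matrix.of fun i j : Fin 2 => if i.val + j.val + 1 = 2 then (1 : L) else 0)).Local v) ⧸
      Subgroup.centralizer ({γ} : Set ((cmDatum L 2 (Matrix.of fun i j : Fin 2 => if i.val + j.val + 1 = 2 then (1 : L) else 0)).Local v)))]
  [∀ γ : (cmDatum L 2 (Matrix.of fun i j : Fin 2 => if i.val + j.val + 1 = 2 then (1 : L) else 0)).Local v,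
    BorelSpace (((cmDatum L 2 (Matrix.of fun i j : Fin 2 => if i.val + j.val + 1 = 2 then (1 : L) else 0)).Local v) ⧸
      Subgroup.centralizer ({γ} : Set ((cmDatum L 2 (Matrix.of fun i j : Fin 2 => if i.val + j.val + 1 = 2 then (1 : L) else 0)).Local v)))]
  [ν.IsMulRightInvariant] in
/-- **`r · ν(K) = [K:I] · (1 − [K:I]⁻¹ − [K′:I]⁻¹)`** for `r := ν(I)⁻¹ − ν(K)⁻¹ − ν(K′)⁻¹` (any Haar `ν`; `ν(K) = [K:I]·ν(I)`, ★ R2 `toReal_measure_coe_eq_relIndex_mul`) —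
the form in which the hyperspecial mass `ν(K)` of ‹J3›'s (HS-C) enters. [cite: Kottwitz1988, §2 Theorem 2] [cite: Rogawski1990, §12.6 p. 174] -/
theorem neg_epValue_mul_toReal_measure_level_eq :
    (((ν (↑(cmLocalIntegralLevel L 2 (Matrix.of fun i j : Fin 2 => if i.val + j.val + 1 = 2 then (1 : L) else 0) v ⊓
            (cmLocalIntegralLevel L 2 (Matrix.of fun i j : Fin 2 => if i.val + j.val + 1 = 2 then (1 : L) else 0) v).map
              (cmDatumLocalNonsplitCongr L w hw (glDiagonal 2 (w.1.adicCompletion L) ![1, ϖ]) ϖ.isUnit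
                (formCongr_glDiagonal_eq_smul_two L w hw ϖ hσϖ)).toMulEquiv.toMonoidHom) :
          Set ((cmDatum L 2 (Matrix.of fun i j : Fin 2 => if i.val + j.val + 1 = 2 then (1 : L) else 0)).Local v))).toReal⁻¹ -
        (ν (cmLocalIntegralLevel L 2 (Matrix.of fun i j : Fin 2 => if i.val + j.val + 1 = 2 then (1 : L) else 0) v :
          Set ((cmDatum L 2 (Matrix.of fun i j : Fin 2 => if i.val + j.val + 1 = 2 then (1 : L) else 0)).Local v))).toReal⁻¹ -
        (ν ((cmLocalIntegralLevel L 2 (Matrix.of fun i j : Fin 2 => if i.val + j.val + 1 = 2 then (1 : L) else 0) v).map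
            (cmDatumLocalNonsplitCongr L w hw (glDiagonal 2 (w.1.adicCompletion L) ![1, ϖ]) ϖ.isUnit
              (formCongr_glDiagonal_eq_smul_two L w hw ϖ hσϖ)).toMulEquiv.toMonoidHom :
          Set ((cmDatum L 2 (Matrix.of fun i j : Fin 2 => if i.val + j.val + 1 = 2 then (1 : L) else 0)).Local v))).toReal⁻¹ : ℝ) : ℂ) *
      ((ν (cmLocalIntegralLevel L 2 (Matrix.of fun i j : Fin 2 => if i.val + j.val + 1 = 2 then (1 : L) else 0) v :
          Set ((cmDatum L 2 (Matrix.of fun i j : Fin 2 => if i.val + j.val + 1 = 2 then (1 : L) else 0)).Local v))).toReal : ℂ) =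
      (((cmLocalIntegralLevel L 2 (Matrix.of fun i j : Fin 2 => if i.val + j.val + 1 = 2 then (1 : L) else 0) v ⊓
            (cmLocalIntegralLevel L 2 (Matrix.of fun i j : Fin 2 => if i.val + j.val + 1 = 2 then (1 : L) else 0) v).map
              (cmDatumLocalNonsplitCongr L w hw (glDiagonal 2 (w.1.adicCompletion L) ![1, ϖ]) ϖ.isUnit
                (formCongr_glDiagonal_eq_smul_two L w hw ϖ hσϖ)).toMulEquiv.toMonoidHom).relIndex
            (cmLocalIntegralLevel L 2 (Matrix.of fun i j : Fin 2 => if i.val + j.val + 1 = 2 then (1 : L) else 0) v) : ℕ) : ℂ) *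
        (1 - (((cmLocalIntegralLevel L 2 (Matrix.of fun i j : Fin 2 => if i.val + j.val + 1 = 2 then (1 : L) else 0) v ⊓
            (cmLocalIntegralLevel L 2 (Matrix.of fun i j : Fin 2 => if i.val + j.val + 1 = 2 then (1 : L) else 0) v).map
              (cmDatumLocalNonsplitCongr L w hw (glDiagonal 2 (w.1.adicCompletion L) ![1, ϖ]) ϖ.isUnit
                (formCongr_glDiagonal_eq_smul_two L w hw ϖ hσϖ)).toMulEquiv.toMonoidHom).relIndex
            (cmLocalIntegralLevel L 2 (Matrix.of fun i j : Fin 2 => if i.val + j.val + 1 = 2 then (1 : L) else 0) v) : ℕ) : ℂ)⁻¹ -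
        (((cmLocalIntegralLevel L 2 (Matrix.of fun i j : Fin 2 => if i.val + j.val + 1 = 2 then (1 : L) else 0) v ⊓
            (cmLocalIntegralLevel L 2 (Matrix.of fun i j : Fin 2 => if i.val + j.val + 1 = 2 then (1 : L) else 0) v).map
              (cmDatumLocalNonsplitCongr L w hw (glDiagonal 2 (w.1.adicCompletion L) ![1, ϖ]) ϖ.isUnit
                (formCongr_glDiagonal_eq_smul_two L w hw ϖ hσϖ)).toMulEquiv.toMonoidHom).relIndex
            ((cmLocalIntegralLevel L 2 (Matrix.of fun i j : Fin 2 => if i.val + j.val + 1 = 2 then (1 : L) else 0) v).map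
              (cmDatumLocalNonsplitCongr L w hw (glDiagonal 2 (w.1.adicCompletion L) ![1, ϖ]) ϖ.isUnit
                (formCongr_glDiagonal_eq_smul_two L w hw ϖ hσϖ)).toMulEquiv.toMonoidHom) : ℕ) : ℂ)⁻¹) := by
  obtain ⟨hKc, hKo⟩ := isCompact_isOpen_cmLocalIntegralLevel L 2 (Matrix.of fun i j : Fin 2 => if i.val + j.val + 1 = 2 then (1 : L) else 0) v
  obtain ⟨hIc, hIo⟩ := isCompact_isOpen_cmLocalIntegralLevel_inf_map L w hw ϖ hσϖ
  rw [← neg_epValue_mul_toReal_measure_inf_eq L w hw ϖ hσϖ ν, toReal_measure_coe_eq_relIndex_mul ν _ _ inf_le_left hKo hKc hIo, Complex.ofReal_mul,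
    Complex.ofReal_natCast]
  ring

/-! ## §3 The letter: ‹J3› v2's EP datum `(f₂, r)` with `r` pinned -/

include hw hϖ hσϖ in
/-- **F5 — THE EP DATUM OF `U(Φ₂)_v` AT AN UNRAMIFIED NON-SPLIT PLACE WITH ITS CONSTANT IN INDEX FORM.**  For `v` unramified in `L`, any two-sided Haar measure `ν`
and canonical orbital measures `m` on `U(Φ₂)_v`: there are `f₂ ∈ C_c^∞(U(Φ₂)_v)` (Kottwitz's EP function of the triple `K, K′ = Ad_d K, I = K ⊓ K′`) and `r : ℝ` with
orbital integrals `1 ∕ 0` on the regular elliptic ∕ split classes, `f₂(b·1) = −r` at every central unit scalar — ‹J3› v2's four EP fields in its binder order — AND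
`0 < r`, `r · ν(I) = 1 − [K:I]⁻¹ − [K′:I]⁻¹`, `r · ν(K) = [K:I]·(1 − [K:I]⁻¹ − [K′:I]⁻¹)`: the `r` of ‹J3› is this explicit number (both indices are `q_v + 1`, brick F5-idx).
[cite: Kottwitz1988, §2 Theorem 2] [cite: Rogawski1990, §8.1 p. 117; §12.6 p. 174] [cite: Serre1980Trees, Ch. II §1.1] -/
theorem exists_epDatum_indexForm_of_unramified (hunr : Algebra.IsUnramifiedIn (𝓞 L) v.asIdeal)
    {m : OrbitalMeasureFamily ((cmDatum L 2 (Matrix.of fun i j : Fin 2 => if i.val + j.val + 1 = 2 then (1 : L) else 0)).Local v)}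
    (hm : m.IsCanonical (fun γ => IsRegularElt (γ.val : GL (Fin 2) (UnitaryGroup.LocalRing L v))) ν) :
    ∃ (f₂ : ((cmDatum L 2 (Matrix.of fun i j : Fin 2 => if i.val + j.val + 1 = 2 then (1 : L) else 0)).Local v) → ℂ) (r : ℝ), IsLocSmooth f₂ ∧
      (∀ γ : (cmDatum L 2 (Matrix.of fun i j : Fin 2 => if i.val + j.val + 1 = 2 then (1 : L) else 0)).Local v,
          IsRegularElt (γ.val : GL (Fin 2) (UnitaryGroup.LocalRing L v)) →
          CompactSpace (Subgroup.centralizer ({γ} : Set ((cmDatum L 2 (Matrix.of fun i j : Fin 2 => if i.val + j.val + 1 = 2 then (1 : L) else 0)).Local v))) →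
          classOrbitalIntegral m f₂ (ConjClasses.mk γ) = 1) ∧
      (∀ γ : (cmDatum L 2 (Matrix.of fun i j : Fin 2 => if i.val + j.val + 1 = 2 then (1 : L) else 0)).Local v,
          IsRegularElt (γ.val : GL (Fin 2) (UnitaryGroup.LocalRing L v)) →
          ¬ CompactSpace (Subgroup.centralizer ({γ} : Set ((cmDatum L 2 (Matrix.of fun i j : Fin 2 => if i.val + j.val + 1 = 2 then (1 : L) else 0)).Local v))) →
          classOrbitalIntegral m f₂ (ConjClasses.mk γ) = 0) ∧
      (∀ (z : (cmDatum L 2 (Matrix.of fun i j : Fin 2 => if i.val + j.val + 1 = 2 then (1 : L) else 0)).Local v) (b : LocalRing L v),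
          ((z.val : GL (Fin 2) (LocalRing L v)).val : Matrix (Fin 2) (Fin 2) (LocalRing L v)) = b • (1 : Matrix (Fin 2) (Fin 2) (LocalRing L v)) →
          f₂ z = -(r : ℂ)) ∧
      0 < r ∧
      (r : ℂ) * ((ν (↑(cmLocalIntegralLevel L 2 (Matrix.of fun i j : Fin 2 => if i.val + j.val + 1 = 2 then (1 : L) else 0) v ⊓
            (cmLocalIntegralLevel L 2 (Matrix.of fun i j : Fin 2 => if i.val + j.val + 1 = 2 then (1 : L) else 0) v).map
              (cmDatumLocalNonsplitCongr L w hw (glDiagonal 2 (w.1.adicCompletion L) ![1, ϖ]) ϖ.isUnit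
                (formCongr_glDiagonal_eq_smul_two L w hw ϖ hσϖ)).toMulEquiv.toMonoidHom) :
          Set ((cmDatum L 2 (Matrix.of fun i j : Fin 2 => if i.val + j.val + 1 = 2 then (1 : L) else 0)).Local v))).toReal : ℂ) =
        1 - (((cmLocalIntegralLevel L 2 (Matrix.of fun i j : Fin 2 => if i.val + j.val + 1 = 2 then (1 : L) else 0) v ⊓
            (cmLocalIntegralLevel L 2 (Matrix.of fun i j : Fin 2 => if i.val + j.val + 1 = 2 then (1 : L) else 0) v).map
              (cmDatumLocalNonsplitCongr L w hw (glDiagonal 2 (w.1.adicCompletion L) ![1, ϖ]) ϖ.isUnit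
                (formCongr_glDiagonal_eq_smul_two L w hw ϖ hσϖ)).toMulEquiv.toMonoidHom).relIndex
            (cmLocalIntegralLevel L 2 (Matrix.of fun i j : Fin 2 => if i.val + j.val + 1 = 2 then (1 : L) else 0) v) : ℕ) : ℂ)⁻¹ -
        (((cmLocalIntegralLevel L 2 (Matrix.of fun i j : Fin 2 => if i.val + j.val + 1 = 2 then (1 : L) else 0) v ⊓
            (cmLocalIntegralLevel L 2 (Matrix.of fun i j : Fin 2 => if i.val + j.val + 1 = 2 then (1 : L) else 0) v).map
              (cmDatumLocalNonsplitCongr L w hw (glDiagonal 2 (w.1.adicCompletion L) ![1, ϖ]) ϖ.isUnit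
                (formCongr_glDiagonal_eq_smul_two L w hw ϖ hσϖ)).toMulEquiv.toMonoidHom).relIndex
            ((cmLocalIntegralLevel L 2 (Matrix.of fun i j : Fin 2 => if i.val + j.val + 1 = 2 then (1 : L) else 0) v).map
              (cmDatumLocalNonsplitCongr L w hw (glDiagonal 2 (w.1.adicCompletion L) ![1, ϖ]) ϖ.isUnit
                (formCongr_glDiagonal_eq_smul_two L w hw ϖ hσϖ)).toMulEquiv.toMonoidHom) : ℕ) : ℂ)⁻¹ ∧
      (r : ℂ) * ((ν (cmLocalIntegralLevel L 2 (Matrix.of fun i j : Fin 2 => if i.val + j.val + 1 = 2 then (1 : L) else 0) v :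
          Set ((cmDatum L 2 (Matrix.of fun i j : Fin 2 => if i.val + j.val + 1 = 2 then (1 : L) else 0)).Local v))).toReal : ℂ) =
        (((cmLocalIntegralLevel L 2 (Matrix.of fun i j : Fin 2 => if i.val + j.val + 1 = 2 then (1 : L) else 0) v ⊓
            (cmLocalIntegralLevel L 2 (Matrix.of fun i j : Fin 2 => if i.val + j.val + 1 = 2 then (1 : L) else 0) v).map
              (cmDatumLocalNonsplitCongr L w hw (glDiagonal 2 (w.1.adicCompletion L) ![1, ϖ]) ϖ.isUnit
                (formCongr_glDiagonal_eq_smul_two L w hw ϖ hσϖ)).toMulEquiv.toMonoidHom).relIndex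
            (cmLocalIntegralLevel L 2 (Matrix.of fun i j : Fin 2 => if i.val + j.val + 1 = 2 then (1 : L) else 0) v) : ℕ) : ℂ) *
        (1 - (((cmLocalIntegralLevel L 2 (Matrix.of fun i j : Fin 2 => if i.val + j.val + 1 = 2 then (1 : L) else 0) v ⊓
            (cmLocalIntegralLevel L 2 (Matrix.of fun i j : Fin 2 => if i.val + j.val + 1 = 2 then (1 : L) else 0) v).map
              (cmDatumLocalNonsplitCongr L w hw (glDiagonal 2 (w.1.adicCompletion L) ![1, ϖ]) ϖ.isUnit
                (formCongr_glDiagonal_eq_smul_two L w hw ϖ hσϖ)).toMulEquiv.toMonoidHom).relIndex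
            (cmLocalIntegralLevel L 2 (Matrix.of fun i j : Fin 2 => if i.val + j.val + 1 = 2 then (1 : L) else 0) v) : ℕ) : ℂ)⁻¹ -
        (((cmLocalIntegralLevel L 2 (Matrix.of fun i j : Fin 2 => if i.val + j.val + 1 = 2 then (1 : L) else 0) v ⊓
            (cmLocalIntegralLevel L 2 (Matrix.of fun i j : Fin 2 => if i.val + j.val + 1 = 2 then (1 : L) else 0) v).map
              (cmDatumLocalNonsplitCongr L w hw (glDiagonal 2 (w.1.adicCompletion L) ![1, ϖ]) ϖ.isUnit
                (formCongr_glDiagonal_eq_smul_two L w hw ϖ hσϖ)).toMulEquiv.toMonoidHom).relIndex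
            ((cmLocalIntegralLevel L 2 (Matrix.of fun i j : Fin 2 => if i.val + j.val + 1 = 2 then (1 : L) else 0) v).map
              (cmDatumLocalNonsplitCongr L w hw (glDiagonal 2 (w.1.adicCompletion L) ![1, ϖ]) ϖ.isUnit
                (formCongr_glDiagonal_eq_smul_two L w hw ϖ hσϖ)).toMulEquiv.toMonoidHom) : ℕ) : ℂ)⁻¹) := by
  obtain ⟨hf, h1, h0, hval, hidx⟩ := epCombination_unramified_spec L w hw ϖ hϖ hσϖ ν hunr hm
  refine ⟨_, _, hf, h1, h0, fun z b hz => ?_, by linarith [sub_pos.2 hidx], neg_epValue_mul_toReal_measure_inf_eq L w hw ϖ hσϖ ν,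
    neg_epValue_mul_toReal_measure_level_eq L w hw ϖ hσϖ ν⟩
  rw [hval z b hz]
  exact inv_add_inv_sub_inv_eq_neg _ _ _

end Summit.HodgeConjecture.HodgeConjecture.Cruxes.H413.K2E3EPConstantIndexFormUnramified

end
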